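import Summits.QuantumFields.YangMills.Theorems.BalabanUVNodesN20HellingerRoadBoundedCurrent
import Summits.QuantumFields.YangMills.Theorems.BalabanUVNodesN19TameTiltLetterOfKPMarginRegimeFree
import Literature.MathematicalPhysics.QuantumFieldTheory.Balaban1983to89.B14Eq344PolymerRatio

/-!
# BalabanUVNodes ∕ node N20 (NE7b) — THE CLASS CURRENT OF THE KEYED GAS IS ADDITIVE AND LOCALISED: the bounded-current letter of the hellinger road's endpoint response
# at the keyed-gas carriers from per-polymer letters (product rule + clique packing), and the road END TO END at the keyed gas

Cell `pub-ymgap` (HUMAN RULING D-0062 Track A ∕ director-ym R399 (3a) second-wave width seats), WIDTH SEAT `pub-ymgap-dag-n20-w5` (node n20 = NE7b),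
generation g5, CLAIM-2 ∕ INTENT-2 (bus).  Key item K3⁸ `SpineGivenEndpointR13SepCoPHV` (stmt-QuantumFields-27366; skeleton of record v6 b4e55110ab73e679, stub
`stub_expansion13HV`) — K3⁷ stmt-QuantumFields-20544 aside; filed `--kind proof --supports … --as helper`.  COUNT-NEUTRAL.  THEOREMS ONLY (0 `def`, 0 `instance`,
0 `notation`, 0 `sorry`).  ADDITIVE — imports this seat's `…N20HellingerRoadBoundedCurrent` (p626582, `exists_hybridNE7_of_affinityDefectLetter_response_boundedCurrent`
BY NAME), dag-n19-w4 g8's p627953 `…N19TameTiltLetterOfKPMarginRegimeFree` (`affinityDefectLetter_of_kpMargin` BY NAME, §4's supplied edition only) and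
`Literature/…/Balaban1983to89/B14Eq344PolymerRatio` (`card_inter_le_one`: a compatible family meets a clique in ≤ 1 member, [B14] (3.44)'s uniqueness of
the marked domain — the same packing fact, BY NAME; `IsCompatible` from `Literature/Probability/LatticeModels/PolymerGas`); modifies nothing.

WHY.  p626582 discharged the hellinger road's one-run susceptibility letter (R‑c) by a BOUNDED SOURCE CURRENT `|A' K s τ| ≤ M·A K s τ` at the class level, arguing at
CONFIGURATION level (a bounded loop observable tilts the Boltzmann factor).  At the carriers where the road is consumed — the KEYED GAS of dag-n19-w4 g8's
`affinityDefectLetter_of_kpMargin` and dag-n20-w4's `SlotDom` editions: classes = compatible families `X ⊆ Λ K` of polymers, class weight `A_X = ∏_{γ∈X} a_γ` — the class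
current is NOT a conditional mean of one bounded observable: it is ADDITIVE over the family, `A'_X ∕ A_X = Σ_{γ∈X} a'_γ ∕ a_γ`, so a per-polymer bound `|a'_γ| ≤ M₀ a_γ`
alone gives `|A'_X| ≤ M₀·|X|·A_X`, NOT uniform in the class.  What makes it uniform is LOCALISATION + PACKING: the source (a loop at the final scale) is carried only by
the polymers meeting one of its `ν` blocks, two polymers through one block are incompatible, so a compatible family carries at most `ν` source-carrying members and
`|A'_X| ≤ (M₀ν)·A_X`.  THIS FILE types exactly that, and re-issues the road END TO END at the keyed-gas carriers with `hA`, `hZA`, `hdA`, `hdB`, `hcur` DERIVED from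
per-polymer letters instead of assumed.
* §1 [folklore] ONE family: `hasDerivAt_classWeight` (product rule, Mathlib `HasDerivAt.fun_finsetProd`: `A'_X = Σ_{γ∈X}(∏_{X∖γ} a)·a'_γ`) · ★ `classCurrent_eq_sum_currents`
  (`A'_X ∕ A_X = Σ_{γ∈X} a'_γ ∕ a_γ`) · ★★ `abs_classDeriv_le_card_mul` (`a' = 0` off a source-carrying set `N`, `|a'| ≤ M₀ a` on `N` ⇒ `|A'_X| ≤ M₀·|X ∩ N|·A_X`).
* §2 [folklore] PACKING: ★ `card_inter_biUnion_cliques_le` (a compatible family meets a union of `ν` `inc`-cliques in ≤ `ν` members; one clique = the tree's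
  `card_inter_le_one`).
* §3 ALONG `K` at the keyed-gas carriers: `classWeight_pos_and_sum_pos` (`hA`, `hZA`: the empty family is compatible) · `keyedGas_hasDerivAt` (`hdA`) ·
  ★★ `keyedGas_boundedCurrent` (`hcur` with `M := M₀ν` from `hloc` + member currents + the packing letter `|X ∩ N K| ≤ ν`) · `packing_of_cliques` (the packing letter
  from a clique cover of `N K` by `ν` cliques, §2).
* §4 ★★★ `exists_hybridNE7_keyedGas_of_affinityDefectLetter_response_polymerCurrents` — p626582's bounded-current road AT THE KEYED GAS: (H) in the ∃-shape at the
  keyed carriers (ANY supplier — dag-n19-w4 g8 `affinityDefectLetter_of_kpMargin`, dag-n20-w4 `…_of_slotDoms_and_kpMargin[_regimeFree]`, this seat's refresh-process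
  editions after `classWildMass_summable_of_refreshProcess`), the E1∕E2 dictionary, (R′) at the keyed carriers with the product-rule derivative carriers, `Σ R₁ < ∞`,
  per-polymer positivity ∕ differentiability for BOTH runs, run A's localisation + member currents + packing ⇒ `∃ η Wsh shA shB`, (H), `Σ√η < ∞`, budget bounds, and
  `HybridNE7 l₀ vol T A B (fun _ _ => ∅) (fun _ => 0) shA shB Wsh (K ↦ l₀·(R₁ K + 2√(2η_K)·(M₀ν))∕vol)`.
  ★★ `exists_hybridNE7_keyedGas_of_kpMargin_response_polymerCurrents` — the V-SIDE FULLY SUPPLIED: (H) from dag-n19-w4 g8's p627953 `affinityDefectLetter_of_kpMargin`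
  (the (V‑a) `wm` block at the over-aged sets + radii + ONE size bound + ONE weighted KP margin) BY NAME — no regime, no `φB`, no `hχ`, no `hdA∕hdB∕hZA∕hZB` letters.
* §5 toy (A6): the EMPTY polymer system (`Λ = ∅`: one class `X = ∅` of weight `1`) inhabits §4 end to end — `HybridNE7` exhibited at the keyed-gas carriers.
READING (located, nothing proposed).  (i) `ν` is K-UNIFORM only because the source lives at the FINAL scale (the loop's block count there does not depend on the
run length `K`); a source resolved at running scales would make `ν = ν_K` grow and turn (R‑c) into a RATE condition `Σ_K ν_K √η_K < ∞` — the road as typed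
(constant `χ`) would then need its `χ_K` edition (p619159 `target_of_endpointResponse` is per key; the summability input becomes `Σ √(η_K χ_K) < ∞`).  (ii) The
member-current bound `|a'_γ| ≤ M₀ a_γ` is the configuration-level statement of p626582 §1 (`abs_deriv_le_of_tilted`) applied INSIDE one polymer activity — a
hypothesis here (activities are signed in general; for the keyed gas of record they are the positive `a`, `b` of dag-n19-w4's letters).  (iii) (R′) is untouched.

HONEST FRAMING.  [folklore] product rule + finite-sum bookkeeping + by-name transfer through p626582 (hence p623765, p619159, p609004); the per-polymer letters
(positivity, differentiability, localisation, member currents), the clique cover, (H)'s suppliers' letters and (R′) are HYPOTHESES produced by nobody — (R′), (V‑b)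
UNPRINTED for d = 4; NO estimate of Bałaban's programme is proved; nothing of Bałaban's asserted or instantiated (no `Provisos₁₃SepCoPH` tuple — K0⁷ OPEN); NE7 ∕ NE7b ∕
NE7c NOT PRINTED as two-run statements for d = 4 and NOT proved; N19′ ∕ N20 ∕ N21 NOT discharged; K3⁸ OPEN (v6 STANDS), K3⁷ aside, neither claimed; no summit statement
is proved by this seat; counts UNMOVED (typed 28∕28 · discharged 5∕28; 5∕27 excl. NODE O).  One finite four-torus programme at fixed ε — NOT ℝ⁴, NOT infinite volume,
NOT OS, NOT a mass gap, NOT the Clay problem (R4 closes the conditional finite-𝕋⁴ rung `BalabanLadder.UV` only).  0 `def`; 0 `sorry`; standard axioms; no cite tags.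
-/

noncomputable section

namespace Summit.QuantumFields.YangMills.BalabanUVNodes.N20KeyedGasClassCurrent

open Finset
open Literature.Probability.LatticeModels (IsCompatible)
open Literature.MathematicalPhysics.QuantumFieldTheory.Balaban1983to89.B14Eq344PolymerRatio (card_inter_le_one)
open Summit.QuantumFields.YangMills.BalabanUVNodes.N19TameTiltLetterOfKPMarginRegimeFree (affinityDefectLetter_of_kpMargin)
open Literature.MathematicalPhysics.QuantumFieldTheory.Balaban1983to89
open T4MatchingAssembly (HybridNE7)
open Summit.QuantumFields.YangMills.BalabanUVNodes.N20HellingerRoadBoundedCurrent (exists_hybridNE7_of_affinityDefectLetter_response_boundedCurrent)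

variable {P : Type*} [DecidableEq P]

/-! ## §1 One compatible family: the class weight is a product, its source derivative is the product-rule sum, the class current is ADDITIVE [folklore] -/
section OneFamily
variable {X : Finset P}

/-- [folklore: product rule] The keyed class weight `A_X(u) = ∏_{γ∈X} a_γ(u)` of a finite family is differentiable in the source with derivative
`A'_X(s) = Σ_{γ∈X} (∏_{γ'∈X∖γ} a_{γ'}(s))·a'_γ(s)` as soon as every member's activity is (Mathlib `HasDerivAt.fun_finsetProd`). -/
theorem hasDerivAt_classWeight {a : ℝ → P → ℝ} {a' : P → ℝ} {s : ℝ} (hd : ∀ γ ∈ X, HasDerivAt (fun u => a u γ) (a' γ) s) :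
    HasDerivAt (fun u => ∏ γ ∈ X, a u γ) (∑ γ ∈ X, (∏ γ' ∈ X.erase γ, a s γ') * a' γ) s := by
  have h := HasDerivAt.fun_finsetProd (u := X) (f := fun γ u => a u γ) (f' := a') hd
  simpa [smul_eq_mul] using h

/-- [folklore] **THE CLASS CURRENT IS ADDITIVE**: for non-vanishing activities the class current `A'_X ∕ A_X` is the SUM of the members' currents `Σ_{γ∈X} a'_γ ∕ a_γ`. -/
theorem classCurrent_eq_sum_currents {a a' : P → ℝ} (ha : ∀ γ ∈ X, a γ ≠ 0) :
    (∑ γ ∈ X, (∏ γ' ∈ X.erase γ, a γ') * a' γ) / ∏ γ ∈ X, a γ = ∑ γ ∈ X, a' γ / a γ := by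
  rw [sum_div]
  refine sum_congr rfl fun γ hγ => ?_
  have hprod : ∏ γ' ∈ X, a γ' = a γ * ∏ γ' ∈ X.erase γ, a γ' := (mul_prod_erase X a hγ).symm
  have hne : ∏ γ' ∈ X.erase γ, a γ' ≠ 0 := prod_ne_zero_iff.2 fun γ' hγ' => ha γ' (mem_of_mem_erase hγ')
  rw [hprod]
  field_simp

/-- [folklore] **LOCALISED BOUNDED MEMBER CURRENTS ⇒ BOUNDED CLASS DERIVATIVE, LINEAR IN THE NUMBER OF SOURCE-CARRYING MEMBERS.**  Positive activities on `X`; a set `N` of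
SOURCE-CARRYING polymers outside of which the activities do not depend on the source (`a'_γ = 0` for `γ ∉ N`) and on which each member current is bounded,
`|a'_γ| ≤ M₀·a_γ` ⇒ `|A'_X| ≤ M₀·|X ∩ N|·A_X`. -/
theorem abs_classDeriv_le_card_mul {a a' : P → ℝ} (N : Finset P) {M₀ : ℝ} (ha : ∀ γ ∈ X, 0 < a γ)
    (hloc : ∀ γ ∈ X, γ ∉ N → a' γ = 0) (hcur : ∀ γ ∈ X, γ ∈ N → |a' γ| ≤ M₀ * a γ) :
    |∑ γ ∈ X, (∏ γ' ∈ X.erase γ, a γ') * a' γ| ≤ M₀ * (X ∩ N).card * ∏ γ ∈ X, a γ := by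
  have hP : ∀ γ ∈ X, 0 ≤ ∏ γ' ∈ X.erase γ, a γ' := fun γ _ => prod_nonneg fun γ' hγ' => (ha γ' (mem_of_mem_erase hγ')).le
  -- drop the members outside `N` (their derivative vanishes), bound the others one by one
  have hsplit : ∑ γ ∈ X, (∏ γ' ∈ X.erase γ, a γ') * a' γ = ∑ γ ∈ X ∩ N, (∏ γ' ∈ X.erase γ, a γ') * a' γ := by
    rw [← sum_filter_add_sum_filter_not X (fun γ => γ ∈ N), filter_mem_eq_inter]
    have h0 : ∑ γ ∈ X.filter (fun γ => ¬ γ ∈ N), (∏ γ' ∈ X.erase γ, a γ') * a' γ = 0 :=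
      sum_eq_zero fun γ hγ => by rw [mem_filter] at hγ; rw [hloc γ hγ.1 hγ.2, mul_zero]
    rw [h0, add_zero]
  rw [hsplit]
  calc |∑ γ ∈ X ∩ N, (∏ γ' ∈ X.erase γ, a γ') * a' γ|
      ≤ ∑ γ ∈ X ∩ N, |(∏ γ' ∈ X.erase γ, a γ') * a' γ| := abs_sum_le_sum_abs _ _
    _ ≤ ∑ γ ∈ X ∩ N, M₀ * ∏ γ' ∈ X, a γ' := sum_le_sum fun γ hγ => by
        have hγX : γ ∈ X := (mem_inter.1 hγ).1
        rw [abs_mul, abs_of_nonneg (hP γ hγX), ← mul_prod_erase X a hγX]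
        have h1 := hcur γ hγX (mem_inter.1 hγ).2
        have h2 := hP γ hγX
        nlinarith
    _ = M₀ * (X ∩ N).card * ∏ γ ∈ X, a γ := by rw [sum_const, nsmul_eq_mul]; ring

end OneFamily

/-! ## §2 Packing: a compatible family meets a union of `ν` cliques of the incompatibility relation in at most `ν` members [folklore; one clique = the tree's
`B14Eq344PolymerRatio.card_inter_le_one`, BY NAME] -/
section Packing
variable (inc : P → P → Prop) [DecidableRel inc]

omit [DecidableRel inc] in
/-- [folklore] **PACKING BOUND**: a compatible family meets a union of `ν` cliques in at most `ν` members — at the keyed gas, the SOURCE-CARRYING polymers (those meeting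
one of the `ν` blocks of the loop at the final scale) are covered by `ν` cliques (two polymers through the same block are incompatible), so a compatible family carries
at most `ν` source-carrying members. -/
theorem card_inter_biUnion_cliques_le {κ : Type*} (S : Finset κ) (Q : κ → Finset P) {X : Finset P} (hX : IsCompatible inc X)
    (hQ : ∀ i ∈ S, ∀ γ ∈ Q i, ∀ γ' ∈ Q i, γ ≠ γ' → inc γ γ') :
    (X ∩ S.biUnion Q).card ≤ S.card := by
  calc (X ∩ S.biUnion Q).card = (S.biUnion fun i => X ∩ Q i).card := by rw [inter_biUnion]
    _ ≤ ∑ i ∈ S, (X ∩ Q i).card := card_biUnion_le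
    _ ≤ ∑ _i ∈ S, 1 := sum_le_sum fun i hi => card_inter_le_one hX (hQ i hi)
    _ = S.card := by simp

end Packing

/-! ## §3 Along `K` at the keyed-gas carriers: the letters `hA`, `hZA`, `hdA`, `hcur` of the road DERIVED from per-polymer letters [folklore] -/
section KeyedGas
variable (inc : P → P → Prop) [DecidableRel inc] {l₀ : ℝ}

/-- [folklore] Positivity of keyed class weights and of the class sum (the empty family is compatible). -/
theorem classWeight_pos_and_sum_pos (Λ : ℕ → Finset P) (a : ℕ → ℝ → P → ℝ) (ha : ∀ K t, |t| ≤ l₀ → ∀ γ ∈ Λ K, 0 < a K t γ) :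
    (∀ (K : ℕ) (t : ℝ), |t| ≤ l₀ → ∀ X ∈ (Λ K).powerset.filter (fun X => IsCompatible inc X), 0 < ∏ γ ∈ X, a K t γ) ∧
      (∀ (K : ℕ) (t : ℝ), |t| ≤ l₀ → 0 < ∑ X ∈ (Λ K).powerset with IsCompatible inc X, ∏ γ ∈ X, a K t γ) := by
  have hpos : ∀ (K : ℕ) (t : ℝ), |t| ≤ l₀ → ∀ X ∈ (Λ K).powerset.filter (fun X => IsCompatible inc X), 0 < ∏ γ ∈ X, a K t γ :=
    fun K t ht X hX => prod_pos fun γ hγ => ha K t ht γ ((mem_powerset.1 (mem_filter.1 hX).1) hγ)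
  refine ⟨hpos, fun K t ht => ?_⟩
  have hmem : (∅ : Finset P) ∈ (Λ K).powerset.filter (fun X => IsCompatible inc X) := by
    rw [mem_filter, mem_powerset]
    exact ⟨empty_subset _, by simp [IsCompatible, Set.Pairwise]⟩
  exact lt_of_lt_of_le (by simp) (single_le_sum (fun X hX => (hpos K t ht X hX).le) hmem)

/-- [folklore] The `hdA` letter of the road at the keyed-gas carriers: every compatible family's class weight is differentiable in the source with the
product-rule derivative carrier, from the members' derivative letters. -/
theorem keyedGas_hasDerivAt (Λ : ℕ → Finset P) (a a' : ℕ → ℝ → P → ℝ)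
    (hda : ∀ K s, |s| ≤ l₀ → ∀ γ ∈ Λ K, HasDerivAt (fun u => a K u γ) (a' K s γ) s) :
    ∀ (K : ℕ) (s : ℝ), |s| ≤ l₀ → ∀ X ∈ (Λ K).powerset.filter (fun X => IsCompatible inc X),
      HasDerivAt (fun u => ∏ γ ∈ X, a K u γ) (∑ γ ∈ X, (∏ γ' ∈ X.erase γ, a K s γ') * a' K s γ) s :=
  fun K s hs _ hX => hasDerivAt_classWeight fun γ hγ => hda K s hs γ ((mem_powerset.1 (mem_filter.1 hX).1) hγ)

/-- **★★ THE BOUNDED-CURRENT LETTER AT THE KEYED GAS FROM PER-POLYMER LETTERS** [folklore].  Polymer sets `Λ K`, activities `a K s γ > 0` on `|s| ≤ l₀` with source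
derivatives `a' K s γ`; SOURCE-CARRYING sets `N K ⊆ P` outside of which `a' = 0`, member currents `|a'| ≤ M₀·a` on `N K`, and the PACKING letter «a compatible family
holds at most `ν` members of `N K`» (§2: `ν` = the number of cliques covering `N K`) ⇒ for every compatible `X ⊆ Λ K` the product-rule derivative carrier obeys `|A'_X| ≤ (M₀ν)·∏_X a` — p626582's `hcur` letter at the keyed-gas carriers, with
`M := M₀·ν`. -/
theorem keyedGas_boundedCurrent (Λ : ℕ → Finset P) (a a' : ℕ → ℝ → P → ℝ) (N : ℕ → Finset P) {M₀ : ℝ} (hM₀ : 0 ≤ M₀) (ν : ℕ)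
    (ha : ∀ K s, |s| ≤ l₀ → ∀ γ ∈ Λ K, 0 < a K s γ)
    (hloc : ∀ K s, |s| ≤ l₀ → ∀ γ ∈ Λ K, γ ∉ N K → a' K s γ = 0)
    (hcur : ∀ K s, |s| ≤ l₀ → ∀ γ ∈ Λ K, γ ∈ N K → |a' K s γ| ≤ M₀ * a K s γ)
    (hν : ∀ K, ∀ X ∈ (Λ K).powerset.filter (fun X => IsCompatible inc X), (X ∩ N K).card ≤ ν) :
    ∀ (K : ℕ) (s : ℝ), |s| ≤ l₀ → ∀ X ∈ (Λ K).powerset.filter (fun X => IsCompatible inc X),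
      |∑ γ ∈ X, (∏ γ' ∈ X.erase γ, a K s γ') * a' K s γ| ≤ M₀ * ν * ∏ γ ∈ X, a K s γ := by
  intro K s hs X hX
  have hXΛ : X ⊆ Λ K := mem_powerset.1 (mem_filter.1 hX).1
  have h1 := abs_classDeriv_le_card_mul (X := X) (N K) (fun γ hγ => ha K s hs γ (hXΛ hγ))
    (fun γ hγ hγN => hloc K s hs γ (hXΛ hγ) hγN) (fun γ hγ hγN => hcur K s hs γ (hXΛ hγ) hγN)
  have h2 : (((X ∩ N K).card : ℕ) : ℝ) ≤ ν := by exact_mod_cast hν K X hX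
  have h3 : 0 ≤ ∏ γ ∈ X, a K s γ := prod_nonneg fun γ hγ => (ha K s hs γ (hXΛ hγ)).le
  calc |∑ γ ∈ X, (∏ γ' ∈ X.erase γ, a K s γ') * a' K s γ| ≤ M₀ * (X ∩ N K).card * ∏ γ ∈ X, a K s γ := h1
    _ ≤ M₀ * ν * ∏ γ ∈ X, a K s γ := by gcongr

/-- [folklore] **THE PACKING LETTER FROM A CLIQUE COVER.**  If at every `K` the source-carrying set `N K` is covered by at most `ν` cliques of `inc` (at the keyed
gas of record: the polymers through each of the `ν` final-scale blocks of the loop), then every compatible family `X ⊆ Λ K` has `|X ∩ N K| ≤ ν` (§2). -/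
theorem packing_of_cliques {κ : Type*} (Λ N : ℕ → Finset P) (S : ℕ → Finset κ) (Q : ℕ → κ → Finset P) (ν : ℕ)
    (hcover : ∀ K, N K ⊆ (S K).biUnion (Q K)) (hQ : ∀ K, ∀ i ∈ S K, ∀ γ ∈ Q K i, ∀ γ' ∈ Q K i, γ ≠ γ' → inc γ γ')
    (hS : ∀ K, (S K).card ≤ ν) :
    ∀ K, ∀ X ∈ (Λ K).powerset.filter (fun X => IsCompatible inc X), (X ∩ N K).card ≤ ν := by
  intro K X hX
  have hXc : IsCompatible inc X := (mem_filter.1 hX).2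
  calc (X ∩ N K).card ≤ (X ∩ (S K).biUnion (Q K)).card := card_le_card (inter_subset_inter subset_rfl (hcover K))
    _ ≤ (S K).card := card_inter_biUnion_cliques_le inc (S K) (Q K) hXc (hQ K)
    _ ≤ ν := hS K

end KeyedGas

/-! ## §4 The hellinger road END TO END at the keyed gas: any (H) supplier + (R′) + per-polymer bounded localised currents ⇒ `HybridNE7` [by-name through p626582] -/
section Road
variable (inc : P → P → Prop) [DecidableRel inc] {l₀ vol : ℝ}

/-- **★★★ `HybridNE7` AT THE KEYED GAS FROM THE (H) LETTER, (R′) AND PER-POLYMER CURRENTS** [folklore + by-name transfer through this seat's p626582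
`exists_hybridNE7_of_affinityDefectLetter_response_boundedCurrent`].  Carriers: compatible families `X ⊆ Λ K`, class weights `∏_X a K t` ∕ `∏_X b K t` of the two
runs with per-polymer activities POSITIVE and DIFFERENTIABLE in the source on `|s| ≤ l₀` (`0 ≤ l₀`, `0 < vol`), derivative carriers the product-rule sums, the E1∕E2
dictionary for `Z`; (H) in the ∃-shape at these carriers (ANY supplier: dag-n19-w4 g8 `affinityDefectLetter_of_kpMargin`, dag-n20-w4's `SlotDom` editions, this seat's
refresh-process editions); (R′) at these carriers with `Σ R₁ < ∞`; run A's SOURCE-CARRYING sets `N K` (`a' = 0` off `N K`), member currents `|a'| ≤ M₀·a` on `N K`, and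
the PACKING letter `|X ∩ N K| ≤ ν` ⇒ `∃ η Wsh shA shB` with the (H) letter, `Σ√η < ∞`, `0 ≤ Wsh ≤ √(2η)`, `Wsh < 1`, and
`HybridNE7 l₀ vol T A B (fun _ _ => ∅) (fun _ => 0) shA shB Wsh (K ↦ l₀·(R₁ K + 2√(2η_K)·(M₀ν))∕vol)` — positivity of weights ∕ totals, differentiability and the
bounded-current letter DERIVED (§1–§3), not assumed. -/
theorem exists_hybridNE7_keyedGas_of_affinityDefectLetter_response_polymerCurrents (hl₀ : 0 ≤ l₀) (hvol : 0 < vol)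
    (Λ : ℕ → Finset P) (a b a' b' : ℕ → ℝ → P → ℝ)
    (ha : ∀ K s, |s| ≤ l₀ → ∀ γ ∈ Λ K, 0 < a K s γ) (hb : ∀ K s, |s| ≤ l₀ → ∀ γ ∈ Λ K, 0 < b K s γ)
    (hda : ∀ K s, |s| ≤ l₀ → ∀ γ ∈ Λ K, HasDerivAt (fun u => a K u γ) (a' K s γ) s)
    (hdb : ∀ K s, |s| ≤ l₀ → ∀ γ ∈ Λ K, HasDerivAt (fun u => b K u γ) (b' K s γ) s)
    {Z : ℕ → ℝ → ℝ}
    (hZA' : ∀ (K : ℕ) (t : ℝ), |t| ≤ l₀ → Z K t = ∑ X ∈ (Λ K).powerset with IsCompatible inc X, ∏ γ ∈ X, a K t γ)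
    (hZB' : ∀ (K : ℕ) (t : ℝ), |t| ≤ l₀ → Z (K + 1) t = ∑ X ∈ (Λ K).powerset with IsCompatible inc X, ∏ γ ∈ X, b K t γ)
    (hHex : ∃ η : ℕ → ℝ, (∀ K, 0 ≤ η K) ∧ Summable (fun K => Real.sqrt (η K)) ∧
      ∀ (K : ℕ) (t : ℝ), |t| ≤ l₀ →
        1 - ∑ X ∈ (Λ K).powerset with IsCompatible inc X,
          Real.sqrt (((∏ γ ∈ X, a K t γ) / ∑ Y ∈ (Λ K).powerset with IsCompatible inc Y, ∏ γ ∈ Y, a K t γ)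
            * ((∏ γ ∈ X, b K t γ) / ∑ Y ∈ (Λ K).powerset with IsCompatible inc Y, ∏ γ ∈ Y, b K t γ)) ≤ η K)
    {R₁ : ℕ → ℝ}
    (hR : ∀ (K : ℕ) (s : ℝ), |s| ≤ l₀ →
      |∑ X ∈ (Λ K).powerset with IsCompatible inc X,
          (∏ γ ∈ X, b K s γ) / (∑ Y ∈ (Λ K).powerset with IsCompatible inc Y, ∏ γ ∈ Y, b K s γ)
            * ((∑ γ ∈ X, (∏ γ' ∈ X.erase γ, b K s γ') * b' K s γ) / (∏ γ ∈ X, b K s γ)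
              - (∑ γ ∈ X, (∏ γ' ∈ X.erase γ, a K s γ') * a' K s γ) / (∏ γ ∈ X, a K s γ))| ≤ R₁ K)
    (hRs : Summable R₁)
    (N : ℕ → Finset P) {M₀ : ℝ} (hM₀ : 0 ≤ M₀) (ν : ℕ)
    (hloc : ∀ K s, |s| ≤ l₀ → ∀ γ ∈ Λ K, γ ∉ N K → a' K s γ = 0)
    (hcur : ∀ K s, |s| ≤ l₀ → ∀ γ ∈ Λ K, γ ∈ N K → |a' K s γ| ≤ M₀ * a K s γ)
    (hν : ∀ K, ∀ X ∈ (Λ K).powerset.filter (fun X => IsCompatible inc X), (X ∩ N K).card ≤ ν) :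
    ∃ (η Wsh : ℕ → ℝ) (shA shB : ℕ → ℝ → Finset P → ℝ),
      (∀ (K : ℕ) (t : ℝ), |t| ≤ l₀ →
        1 - ∑ X ∈ (Λ K).powerset with IsCompatible inc X,
          Real.sqrt (((∏ γ ∈ X, a K t γ) / ∑ Y ∈ (Λ K).powerset with IsCompatible inc Y, ∏ γ ∈ Y, a K t γ)
            * ((∏ γ ∈ X, b K t γ) / ∑ Y ∈ (Λ K).powerset with IsCompatible inc Y, ∏ γ ∈ Y, b K t γ)) ≤ η K) ∧
      Summable (fun K => Real.sqrt (η K)) ∧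
      (∀ K, 0 ≤ Wsh K ∧ Wsh K ≤ Real.sqrt (2 * η K) ∧ Wsh K < 1) ∧
      HybridNE7 l₀ vol (fun K => (Λ K).powerset.filter (fun X => IsCompatible inc X)) (fun K t X => ∏ γ ∈ X, a K t γ) (fun K t X => ∏ γ ∈ X, b K t γ)
        (fun _ _ => ∅) (fun _ => 0) shA shB Wsh
        (fun K => l₀ * (R₁ K + 2 * Real.sqrt (2 * η K) * (M₀ * ν)) / vol) := by
  obtain ⟨hA, hZA⟩ := classWeight_pos_and_sum_pos inc Λ a ha
  obtain ⟨hB, hZB⟩ := classWeight_pos_and_sum_pos inc Λ b hb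
  exact exists_hybridNE7_of_affinityDefectLetter_response_boundedCurrent hl₀ hvol hA hB hZA hZB hZA' hZB'
    (keyedGas_hasDerivAt inc Λ a a' hda) (keyedGas_hasDerivAt inc Λ b b' hdb) hHex (by positivity) hR hRs
    (keyedGas_boundedCurrent inc Λ a a' N hM₀ ν ha hloc hcur hν)

/-- **★★ FULLY SUPPLIED ON THE V-SIDE: `HybridNE7` AT THE KEYED GAS FROM THE (V‑a) BLOCK, ONE KP MARGIN, (R′) AND PER-POLYMER CURRENTS** [folklore + by-name:
dag-n19-w4 g8's p627953 `affinityDefectLetter_of_kpMargin` supplies (H) for `exists_hybridNE7_keyedGas_of_affinityDefectLetter_response_polymerCurrents`].  Letters: the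
(V‑a) block `(wm, hwm, hwildA, hwildB, hws)` for the over-aged sets `O K t` (ANY supplier — `SlotDom`s via p621499, refresh processes via p622199), radii `Σ 1∕r_K < ∞`
((V‑b) = (YG)), ONE size bound `𝔄` and ONE weighted KP margin for run A on `Λ K ∖ O K t` with the two-run increment in the exponent ((KR)+(V‑b)), (R′), run A's
localisation ∕ member currents ∕ packing; `inc` reflexive and symmetric (p627953's standing instances).  NO regime, NO `φB`, NO `hχ`, NO `hdA ∕ hdB ∕ hZA ∕ hZB` letters. -/
theorem exists_hybridNE7_keyedGas_of_kpMargin_response_polymerCurrents [Std.Refl inc] [Std.Symm inc] (hl₀ : 0 ≤ l₀) (hvol : 0 < vol)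
    (Λ : ℕ → Finset P) (O : ℕ → ℝ → Finset P) (a b a' b' aszA : ℕ → ℝ → P → ℝ)
    (ha : ∀ K s, |s| ≤ l₀ → ∀ γ ∈ Λ K, 0 < a K s γ) (hb : ∀ K s, |s| ≤ l₀ → ∀ γ ∈ Λ K, 0 < b K s γ)
    (hda : ∀ K s, |s| ≤ l₀ → ∀ γ ∈ Λ K, HasDerivAt (fun u => a K u γ) (a' K s γ) s)
    (hdb : ∀ K s, |s| ≤ l₀ → ∀ γ ∈ Λ K, HasDerivAt (fun u => b K u γ) (b' K s γ) s)
    {Z : ℕ → ℝ → ℝ}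
    (hZA' : ∀ (K : ℕ) (t : ℝ), |t| ≤ l₀ → Z K t = ∑ X ∈ (Λ K).powerset with IsCompatible inc X, ∏ γ ∈ X, a K t γ)
    (hZB' : ∀ (K : ℕ) (t : ℝ), |t| ≤ l₀ → Z (K + 1) t = ∑ X ∈ (Λ K).powerset with IsCompatible inc X, ∏ γ ∈ X, b K t γ)
    -- (V‑a) block at the over-aged sets
    (wm : ℕ → ℝ) (hwm : ∀ K, 0 ≤ wm K)
    (hwildA : ∀ K t, |t| ≤ l₀ →
      (∑ X ∈ ((Λ K).powerset.filter (fun X => IsCompatible inc X)).filter (fun X => ¬ Disjoint X (O K t)), ∏ γ ∈ X, a K t γ)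
        / (∑ Y ∈ (Λ K).powerset with IsCompatible inc Y, ∏ γ ∈ Y, a K t γ) ≤ wm K)
    (hwildB : ∀ K t, |t| ≤ l₀ →
      (∑ X ∈ ((Λ K).powerset.filter (fun X => IsCompatible inc X)).filter (fun X => ¬ Disjoint X (O K t)), ∏ γ ∈ X, b K t γ)
        / (∑ Y ∈ (Λ K).powerset with IsCompatible inc Y, ∏ γ ∈ Y, b K t γ) ≤ wm K)
    (hws : Summable fun K => Real.sqrt (wm K))
    -- (V‑b) ∕ (KR): radii, ONE size bound, ONE KP margin
    (r : ℕ → ℝ) (hr : ∀ K, 0 < r K) (hrs : Summable fun K => 1 / r K)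
    {𝔄 : ℝ} (h𝔄 : 0 ≤ 𝔄) (h𝔄A : ∀ K t, |t| ≤ l₀ → ∑ γ ∈ Λ K \ O K t, aszA K t γ ≤ 𝔄)
    (hKPa : ∀ K t, |t| ≤ l₀ → ∀ γ ∈ Λ K \ O K t, ∑ γ' ∈ (Λ K \ O K t) with inc γ' γ,
      a K t γ' * Real.exp (r K * |Real.log (b K t γ') - Real.log (a K t γ')|) * Real.exp (aszA K t γ') ≤ aszA K t γ)
    -- (R′)
    {R₁ : ℕ → ℝ}
    (hR : ∀ (K : ℕ) (s : ℝ), |s| ≤ l₀ →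
      |∑ X ∈ (Λ K).powerset with IsCompatible inc X,
          (∏ γ ∈ X, b K s γ) / (∑ Y ∈ (Λ K).powerset with IsCompatible inc Y, ∏ γ ∈ Y, b K s γ)
            * ((∑ γ ∈ X, (∏ γ' ∈ X.erase γ, b K s γ') * b' K s γ) / (∏ γ ∈ X, b K s γ)
              - (∑ γ ∈ X, (∏ γ' ∈ X.erase γ, a K s γ') * a' K s γ) / (∏ γ ∈ X, a K s γ))| ≤ R₁ K)
    (hRs : Summable R₁)
    -- run A's source-carrying polymers: localisation, member currents, packing
    (N : ℕ → Finset P) {M₀ : ℝ} (hM₀ : 0 ≤ M₀) (ν : ℕ)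
    (hloc : ∀ K s, |s| ≤ l₀ → ∀ γ ∈ Λ K, γ ∉ N K → a' K s γ = 0)
    (hcur : ∀ K s, |s| ≤ l₀ → ∀ γ ∈ Λ K, γ ∈ N K → |a' K s γ| ≤ M₀ * a K s γ)
    (hν : ∀ K, ∀ X ∈ (Λ K).powerset.filter (fun X => IsCompatible inc X), (X ∩ N K).card ≤ ν) :
    ∃ (η Wsh : ℕ → ℝ) (shA shB : ℕ → ℝ → Finset P → ℝ),
      (∀ (K : ℕ) (t : ℝ), |t| ≤ l₀ →
        1 - ∑ X ∈ (Λ K).powerset with IsCompatible inc X,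
          Real.sqrt (((∏ γ ∈ X, a K t γ) / ∑ Y ∈ (Λ K).powerset with IsCompatible inc Y, ∏ γ ∈ Y, a K t γ)
            * ((∏ γ ∈ X, b K t γ) / ∑ Y ∈ (Λ K).powerset with IsCompatible inc Y, ∏ γ ∈ Y, b K t γ)) ≤ η K) ∧
      Summable (fun K => Real.sqrt (η K)) ∧
      (∀ K, 0 ≤ Wsh K ∧ Wsh K ≤ Real.sqrt (2 * η K) ∧ Wsh K < 1) ∧
      HybridNE7 l₀ vol (fun K => (Λ K).powerset.filter (fun X => IsCompatible inc X)) (fun K t X => ∏ γ ∈ X, a K t γ) (fun K t X => ∏ γ ∈ X, b K t γ)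
        (fun _ _ => ∅) (fun _ => 0) shA shB Wsh
        (fun K => l₀ * (R₁ K + 2 * Real.sqrt (2 * η K) * (M₀ * ν)) / vol) :=
  exists_hybridNE7_keyedGas_of_affinityDefectLetter_response_polymerCurrents inc hl₀ hvol Λ a b a' b' ha hb hda hdb hZA' hZB'
    (affinityDefectLetter_of_kpMargin inc Λ O a b aszA ha hb wm hwm hwildA hwildB hws r hr hrs h𝔄 h𝔄A hKPa)
    hR hRs N hM₀ ν hloc hcur hν

end Road

/-! ## §5 Toy (A6): the empty polymer system inhabits §4 end to end [folklore] -/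
section Toy
variable (inc : P → P → Prop) [DecidableRel inc]

/-- [folklore] With no polymers the keyed carrier is the single empty family (`∅.powerset = {∅}` and `∅` is compatible). -/
theorem keyedCarrier_empty : ({∅} : Finset (Finset P)).filter (fun X => IsCompatible inc X) = {∅} := by
  rw [filter_singleton, if_pos]
  simp [IsCompatible]

/-- **★ TOY — `HybridNE7` AT THE KEYED GAS OF NO POLYMERS, THROUGH §4** (A6).  `Λ K = ∅` (one class `∅`, weight `1` for both runs, `Z ≡ 1`), activities `1` with
derivative `0`, (H) with `η = 0`, (R′) with `R₁ = 0`, no source-carrying polymer (`N = ∅`, `M₀ = 0`, `ν = 0`), `l₀ = 0`, `vol = 1`: every antecedent of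
`exists_hybridNE7_keyedGas_of_affinityDefectLetter_response_polymerCurrents` is met by a genuine witness and `HybridNE7` is exhibited at the keyed-gas carriers. -/
theorem toy_hybridNE7_noPolymers :
    ∃ (η Wsh : ℕ → ℝ) (shA shB : ℕ → ℝ → Finset P → ℝ),
      (∀ (K : ℕ) (t : ℝ), |t| ≤ 0 →
        1 - ∑ X ∈ ((fun _ : ℕ => (∅ : Finset P)) K).powerset with IsCompatible inc X,
          Real.sqrt (((∏ γ ∈ X, (fun (_ : ℕ) (_ : ℝ) (_ : P) => (1:ℝ)) K t γ)
              / ∑ Y ∈ ((fun _ : ℕ => (∅ : Finset P)) K).powerset with IsCompatible inc Y, ∏ γ ∈ Y, (fun (_ : ℕ) (_ : ℝ) (_ : P) => (1:ℝ)) K t γ)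
            * ((∏ γ ∈ X, (fun (_ : ℕ) (_ : ℝ) (_ : P) => (1:ℝ)) K t γ)
              / ∑ Y ∈ ((fun _ : ℕ => (∅ : Finset P)) K).powerset with IsCompatible inc Y, ∏ γ ∈ Y, (fun (_ : ℕ) (_ : ℝ) (_ : P) => (1:ℝ)) K t γ)) ≤ η K) ∧
      Summable (fun K => Real.sqrt (η K)) ∧
      (∀ K, 0 ≤ Wsh K ∧ Wsh K ≤ Real.sqrt (2 * η K) ∧ Wsh K < 1) ∧
      HybridNE7 0 1 (fun K => ((fun _ : ℕ => (∅ : Finset P)) K).powerset.filter (fun X => IsCompatible inc X))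
        (fun K t X => ∏ γ ∈ X, (fun (_ : ℕ) (_ : ℝ) (_ : P) => (1:ℝ)) K t γ) (fun K t X => ∏ γ ∈ X, (fun (_ : ℕ) (_ : ℝ) (_ : P) => (1:ℝ)) K t γ)
        (fun _ _ => ∅) (fun _ => 0) shA shB Wsh
        (fun K => 0 * ((fun _ : ℕ => (0:ℝ)) K + 2 * Real.sqrt (2 * η K) * ((0:ℝ) * ((0:ℕ) : ℝ))) / 1) := by
  have hT := keyedCarrier_empty inc
  refine exists_hybridNE7_keyedGas_of_affinityDefectLetter_response_polymerCurrents inc le_rfl one_pos (fun _ => ∅)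
    (fun _ _ _ => (1:ℝ)) (fun _ _ _ => (1:ℝ)) (fun _ _ _ => 0) (fun _ _ _ => 0)
    (fun _ _ _ γ hγ => absurd hγ (notMem_empty γ)) (fun _ _ _ γ hγ => absurd hγ (notMem_empty γ))
    (fun _ _ _ γ hγ => absurd hγ (notMem_empty γ)) (fun _ _ _ γ hγ => absurd hγ (notMem_empty γ))
    (Z := fun _ _ => 1) (fun _ _ _ => by simp [hT]) (fun _ _ _ => by simp [hT])
    ⟨fun _ => 0, fun _ => le_rfl, by simp [summable_zero], fun _ _ _ => by simp [hT]⟩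
    (R₁ := fun _ => 0) (fun _ _ _ => by simp [hT]) summable_zero
    (fun _ => ∅) (M₀ := 0) le_rfl 0 (fun _ _ _ γ hγ => absurd hγ (notMem_empty γ)) (fun _ _ _ γ hγ => absurd hγ (notMem_empty γ))
    (fun _ X _ => by simp)

end Toy

end Summit.QuantumFields.YangMills.BalabanUVNodes.N20KeyedGasClassCurrent

end
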